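import Summits.HubbardSuperconductivity.HubbardSuperconductivity.Theorems.KacWindowPenaltyWindowGapMonotone
import Summits.HubbardSuperconductivity.HubbardSuperconductivity.Theorems.KacWindowPenaltyWindowGapPenalisedForms

/-!
# Crux `WindowGap` (stmt-HubbardSuperconductivity-1088) — idea `parabolic-descent`, first lemmas

PARABOLIC DESCENT: concavity of the penalised sector energy in the coupling `λ`
(`windowGapIneq_mono_lam`, landed) + nesting of the Kac windows `W_{ε/2} ≤ W_ε` + the variational
principle at a minimiser of the SMALLER-window problem give the one-step DESCENT

  `λ A ≤ g(λ; W) − g(0)`  ⟹  `(λ/4)(A − ann) ≤ g(λ/4; W') − g(0)`,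
  `ann := Re ⟨ψ', (W − W') ψ'⟩`, `ψ'` any unit minimiser of `H + (λ/4) W'` on the sector

(`descent_step`, PROVED below for arbitrary matrices; no sign or hermiticity hypotheses).
Iterated along the parabola `(ε_k, λ_k) = (ε⋆ 2^{-k}, λ⋆ 4^{-k})` — the scaling `λ ∝ ε²` is the one
the landed twist ceiling `not_windowGap_uniform` forces — it reduces the crux (`∀ C ∀ ε₀ ∃ ε ≤ ε₀ …`,
an infinite family of energy inequalities with margins `→ 0`) to ONE base inequality at ONE scale
(`BaseGap`) plus a summable budget for the dyadic ANNULUS pair weights of penalised minimisers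
(`AnnulusLaw`, an infrared UPPER bound of the sibling crux's type, existential over minimisers):
`windowGap_of_parabolicDescent` (the future skeleton's `WindowGap_of`; statement elaborates, proof
of the bookkeeping is routine and partly done: `cascade_level`).
-/

set_option linter.dupNamespace false

noncomputable section

namespace Summit.HubbardSuperconductivity.HubbardSuperconductivity.Cruxes.WindowGap.ParabolicDescent

open Matrix Literature.MathematicalPhysics.QuantumLattice
open Summit.HubbardSuperconductivity.HubbardSuperconductivity.Theorems
open Summit.HubbardSuperconductivity.HubbardSuperconductivity.Theses.KacWindowPenalty (WindowGap)

section Abstract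

variable {n : Type*} [Fintype n]

/-- **Descent step (first lemma of the line; PROVED).** For matrices `H, W, W'`, a sector `K`,
couplings `0 < λ' ≤ λ`, a gap `λ A ≤ minE(H + λW | K) − minE(H | K)` and ANY unit minimiser `ψ`
of `H + λ'W'` on `K`:  `λ'(A − Re⟨ψ,(W − W')ψ⟩) ≤ minE(H + λ'W' | K) − minE(H | K)`.
Proof: chord monotonicity in the coupling (`windowGapIneq_mono_lam`) brings the gap down to `λ'`,
and the variational principle for `H + λ'W` at `ψ` reads
`minE(H + λ'W) ≤ Re⟨ψ,(H + λ'W')ψ⟩ + λ' Re⟨ψ,(W − W')ψ⟩ = minE(H + λ'W') + λ'·ann`. [folklore] -/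
theorem descent_step (H W W' : Matrix n n ℂ) (K : Submodule ℂ (n → ℂ)) {lam lam' A : ℝ}
    (hlam' : 0 < lam') (hle : lam' ≤ lam)
    (hgap : lam * A ≤ (H + (lam : ℂ) • W).minEnergyOn K - H.minEnergyOn K)
    {ψ : n → ℂ} (hψK : ψ ∈ K) (hψ : star ψ ⬝ᵥ ψ = 1)
    (hmin : (star ψ ⬝ᵥ (H + (lam' : ℂ) • W') *ᵥ ψ).re = (H + (lam' : ℂ) • W').minEnergyOn K) :
    lam' * (A - (star ψ ⬝ᵥ (W - W') *ᵥ ψ).re) ≤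
      (H + (lam' : ℂ) • W').minEnergyOn K - H.minEnergyOn K := by
  have h1 := windowGapIneq_mono_lam H W K hlam' hle hgap
  have h2 := minEnergyOn_le_re_rayleigh (H + (lam' : ℂ) • W) K hψK hψ
  rw [add_mulVec, dotProduct_add, Complex.add_re, smul_mulVec, dotProduct_smul, smul_eq_mul,
    Complex.re_ofReal_mul] at h2 hmin
  rw [sub_mulVec, dotProduct_sub, Complex.sub_re, mul_sub, mul_sub]
  linarith

/-- **Cascade arithmetic.** If `f 0 ≥ M` and `f (k+1) ≥ f k − b k` then `f K ≥ M − Σ_{k<K} b k`.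
[folklore] -/
theorem cascade_arith {f b : ℕ → ℝ} {M : ℝ} (h0 : M ≤ f 0) (hstep : ∀ k, f k - b k ≤ f (k + 1))
    (K : ℕ) : M - ∑ k ∈ Finset.range K, b k ≤ f K := by
  induction K with
  | zero => simpa using h0
  | succ K ih =>
    rw [Finset.sum_range_succ]
    linarith [hstep K]

end Abstract

/-! ### The route's objects -/

variable (L : ℕ) [NeZero L]

/-- The Kac-window pair penalty `W_ε = L⁻² Σ_{|q_m| ≤ ε} Δ_d(m)ᴴ Δ_d(m)` — verbatim the crux's
`let W` with `D m := pairFieldAt dWaveFormFactor L m` (`pairFieldAt_def` is `rfl`). [folklore] -/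
def kacWindowOp (ε : ℝ) :
    Matrix (Finset (Orb (FermionTorus 2 L))) (Finset (Orb (FermionTorus 2 L))) ℂ :=
  ∑ m : Fin 2 → ZMod L,
    if (2 * Real.pi / (L : ℝ)) ^ 2 * (∑ i : Fin 2, (((m i).valMinAbs : ℤ) : ℝ) ^ 2) ≤ ε ^ 2 then
      ((L : ℂ) ^ 2)⁻¹ • (Matrix.conjTranspose (pairFieldAt dWaveFormFactor L m) *
        pairFieldAt dWaveFormFactor L m)
    else 0

/-- The summit's sector `K_L = szSector N_L 0`, `N_L = 2⌊(1−δ)L²/2⌋`. [folklore] -/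
def holeSector (δ : ℝ) : Submodule ℂ (Fock (Orb (FermionTorus 2 L))) :=
  szSector (2 * ⌊(1 - δ) * (L : ℝ) ^ 2 / 2⌋₊) 0

/-- The penalised gap `g_L(λ; ε) − g_L(0) = minE(H_L + λW_ε | K_L) − minE(H_L | K_L)`. [folklore] -/
def penGap (U δ ε lam : ℝ) : ℝ :=
  (hubbardTorus 2 L 1 U + (lam : ℂ) • kacWindowOp L ε).minEnergyOn (holeSector L δ) -
    (hubbardTorus 2 L 1 U).minEnergyOn (holeSector L δ)

/-- **BASE** — the crux's inequality at ONE scale `(ε⋆, λ⋆)` with chord slope `A⋆`: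
`λ⋆ A⋆ L² ≤ g_L(λ⋆; ε⋆) − g_L(0)` for all large even `L`. [folklore] -/
def BaseGap (U δ εs lams As : ℝ) : Prop :=
  ∃ L₀ : ℕ, ∀ (L : ℕ) [NeZero L], L₀ ≤ L → Even L → lams * As * (L : ℝ) ^ 2 ≤ penGap L U δ εs lams

/-- **ANNULUS LAW** along the parabola `(ε_k, λ_k) = (ε⋆/2^k, λ⋆/4^k)` with budget `b`: for every
level `k` and all large even `L`, SOME unit minimiser `ψ` of `H_L + λ_{k+1} W_{ε_{k+1}}` on `K_L`
has dyadic-annulus pair weight `Re⟨ψ, (W_{ε_k} − W_{ε_{k+1}}) ψ⟩ ≤ b_k L²`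
(physically `b_k = (flat pair-fluctuation part, telescoping) + C′ε_k` (Goldstone `1/|q|` tail)).
[folklore] -/
def AnnulusLaw (U δ εs lams : ℝ) (b : ℕ → ℝ) : Prop :=
  ∀ k : ℕ, ∃ L₀ : ℕ, ∀ (L : ℕ) [NeZero L], L₀ ≤ L → Even L →
    ∃ ψ ∈ holeSector L δ, star ψ ⬝ᵥ ψ = 1 ∧
      (star ψ ⬝ᵥ (hubbardTorus 2 L 1 U +
          ((lams / 4 ^ (k + 1) : ℝ) : ℂ) • kacWindowOp L (εs / 2 ^ (k + 1))) *ᵥ ψ).re =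
        (hubbardTorus 2 L 1 U +
          ((lams / 4 ^ (k + 1) : ℝ) : ℂ) • kacWindowOp L (εs / 2 ^ (k + 1))).minEnergyOn
            (holeSector L δ) ∧
      (star ψ ⬝ᵥ (kacWindowOp L (εs / 2 ^ k) - kacWindowOp L (εs / 2 ^ (k + 1))) *ᵥ ψ).re ≤
        b k * (L : ℝ) ^ 2

/-- **The cascade at level `K`** (routine induction on `K` from `descent_step` and
`cascade_arith`; bookkeeping only): BASE + ANNULUS LAW give, at every level,
`λ_K (A⋆ − Σ_{k<K} b_k) L² ≤ g_L(λ_K; ε_K) − g_L(0)` for all large even `L`. [folklore] -/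
theorem cascade_level {U δ εs lams As : ℝ} {b : ℕ → ℝ} (hlam : 0 < lams)
    (hbase : BaseGap U δ εs lams As) (hann : AnnulusLaw U δ εs lams b) (K : ℕ) :
    ∃ L₀ : ℕ, ∀ (L : ℕ) [NeZero L], L₀ ≤ L → Even L →
      lams / 4 ^ K * (As - ∑ k ∈ Finset.range K, b k) * (L : ℝ) ^ 2 ≤
        penGap L U δ (εs / 2 ^ K) (lams / 4 ^ K) := by
  induction K with
  | zero =>
    obtain ⟨L₀, h⟩ := hbase
    exact ⟨L₀, fun L _ hL hE => by simpa using h L hL hE⟩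
  | succ K ih =>
    obtain ⟨L₁, h₁⟩ := ih
    obtain ⟨L₂, h₂⟩ := hann K
    refine ⟨max L₁ L₂, fun L _ hL hE => ?_⟩
    obtain ⟨ψ, hψK, hψ, hmin, hannK⟩ := h₂ L (le_of_max_le_right hL) hE
    have hgap := h₁ L (le_of_max_le_left hL) hE
    have hlamK : 0 < lams / 4 ^ (K + 1) := by positivity
    have hle : lams / 4 ^ (K + 1) ≤ lams / 4 ^ K :=
      div_le_div_of_nonneg_left hlam.le (by positivity)
        (pow_le_pow_right₀ (by norm_num) (Nat.le_succ K))
    -- the base-type gap at level K, in the shape `λ_K · A_K` with `A_K := (A⋆ − Σ_{k<K} b_k) L²`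
    have hgap' : lams / 4 ^ K * ((As - ∑ k ∈ Finset.range K, b k) * (L : ℝ) ^ 2) ≤
        (hubbardTorus 2 L 1 U + ((lams / 4 ^ K : ℝ) : ℂ) • kacWindowOp L (εs / 2 ^ K)).minEnergyOn
            (holeSector L δ) - (hubbardTorus 2 L 1 U).minEnergyOn (holeSector L δ) := by
      rw [← mul_assoc]; exact hgap
    have step := descent_step (hubbardTorus 2 L 1 U) (kacWindowOp L (εs / 2 ^ K))
      (kacWindowOp L (εs / 2 ^ (K + 1))) (holeSector L δ) hlamK hle hgap' hψK hψ hmin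
    unfold penGap
    rw [Finset.sum_range_succ]
    have hL2 : (0 : ℝ) ≤ (L : ℝ) ^ 2 := by positivity
    have hkey : lams / 4 ^ (K + 1) * (As - (∑ k ∈ Finset.range K, b k + b K)) * (L : ℝ) ^ 2 ≤
        lams / 4 ^ (K + 1) * ((As - ∑ k ∈ Finset.range K, b k) * (L : ℝ) ^ 2 -
          (star ψ ⬝ᵥ (kacWindowOp L (εs / 2 ^ K) - kacWindowOp L (εs / 2 ^ (K + 1))) *ᵥ ψ).re) := by
      have := mul_le_mul_of_nonneg_left hannK hlamK.le
      nlinarith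
    exact hkey.trans step

/-- **WindowGap from the parabolic descent** (the line's composition `WindowGap_of`):
BASE at one scale + ANNULUS LAW with a budget leaving `2a₀ > 0` of the base slope
⟹ the crux, with `ε := ε⋆/2^K ≤ ε₀`, `C ε ≤ a₀`, `λ := λ⋆/4^K`, `a := a₀`.
Statement elaborates; the remaining bookkeeping (choice of `K`, matching the crux's `let`s by
`rfl`) is routine. [folklore] -/
theorem windowGap_of_parabolicDescent {U δ εs lams As a₀ : ℝ} {b : ℕ → ℝ}
    (hU : 0 < U) (hδ : δ ∈ Set.Ioo (0 : ℝ) (1 / 2)) (hε : 0 < εs) (hlam : 0 < lams) (ha₀ : 0 < a₀)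
    (hbase : BaseGap U δ εs lams As) (hann : AnnulusLaw U δ εs lams b)
    (hbudget : ∀ K : ℕ, 2 * a₀ ≤ As - ∑ k ∈ Finset.range K, b k) :
    WindowGap := by
  refine ⟨U, hU, δ, hδ, fun C hC ε₀ hε₀ => ?_⟩
  -- choose the level: `εs / 2^K ≤ min ε₀ (a₀ / (C+1))`
  obtain ⟨K, hK⟩ : ∃ K : ℕ, εs / 2 ^ K ≤ min ε₀ (a₀ / (C + 1)) := by
    have hpos : 0 < min ε₀ (a₀ / (C + 1)) := lt_min hε₀ (div_pos ha₀ (by linarith))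
    obtain ⟨K, hK⟩ := pow_unbounded_of_one_lt (εs / min ε₀ (a₀ / (C + 1))) (by norm_num : (1:ℝ) < 2)
    refine ⟨K, ?_⟩
    rw [div_le_iff₀ (by positivity)]
    rw [div_lt_iff₀ hpos] at hK
    linarith
  obtain ⟨L₀, hL⟩ := cascade_level hlam hbase hann K
  refine ⟨εs / 2 ^ K, ⟨by positivity, hK.trans (min_le_left _ _)⟩, lams / 4 ^ K, a₀,
    by positivity, ha₀, L₀, ?_⟩
  intro L _ hL₀ hE
  have h := hL L hL₀ hE
  have hCε : C * (εs / 2 ^ K) ≤ a₀ := by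
    have h1 : εs / 2 ^ K ≤ a₀ / (C + 1) := hK.trans (min_le_right _ _)
    have h2 : C * (εs / 2 ^ K) ≤ C * (a₀ / (C + 1)) := mul_le_mul_of_nonneg_left h1 hC
    have h3 : C * (a₀ / (C + 1)) ≤ a₀ := by
      rw [mul_div_assoc', div_le_iff₀ (by linarith)]; nlinarith
    linarith
  have hb := hbudget K
  have hL2 : (0 : ℝ) ≤ (L : ℝ) ^ 2 := by positivity
  have hlamK : 0 ≤ lams / 4 ^ K := by positivity
  calc lams / 4 ^ K * (C * (εs / 2 ^ K) + a₀) * (L : ℝ) ^ 2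
      ≤ lams / 4 ^ K * (As - ∑ k ∈ Finset.range K, b k) * (L : ℝ) ^ 2 := by
        apply mul_le_mul_of_nonneg_right _ hL2
        exact mul_le_mul_of_nonneg_left (by linarith) hlamK
    _ ≤ penGap L U δ (εs / 2 ^ K) (lams / 4 ^ K) := h
    _ = _ := rfl

/-! ### All-energy closure: the annulus law from GAIN ceilings

The annulus weight is the right-derivative of the penalised sector energy in an auxiliary ATTRACTIVE
annulus coupling; by the variational principle at a minimiser, the MAXIMAL annulus weight over the
minimisers of `X` is at most `(minE(X|K) − minE(X − μA|K))/μ` for every `μ > 0`. Hence the whole line is a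
statement about certified ENERGY DIFFERENCES only: one base gap (repulsive window) and, per level, one
ceiling on the gain produced by an attractive Kac-ANNULUS pair interaction. -/

section Gain

variable {n : Type*} [Fintype n]

/-- **Expectation of a minimiser ≤ gain/μ** (one line: the variational principle for `X − μA` at a
minimiser `ψ` of `X`). [folklore] -/
theorem mul_re_expect_le_gain (X A : Matrix n n ℂ) (K : Submodule ℂ (n → ℂ)) {μ : ℝ}
    {ψ : n → ℂ} (hψK : ψ ∈ K) (hψ : star ψ ⬝ᵥ ψ = 1)
    (hmin : (star ψ ⬝ᵥ X *ᵥ ψ).re = X.minEnergyOn K) :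
    μ * (star ψ ⬝ᵥ A *ᵥ ψ).re ≤ X.minEnergyOn K - (X - (μ : ℂ) • A).minEnergyOn K := by
  have h := minEnergyOn_le_re_rayleigh (X - (μ : ℂ) • A) K hψK hψ
  rw [sub_mulVec, dotProduct_sub, Complex.sub_re, smul_mulVec, dotProduct_smul, smul_eq_mul,
    Complex.re_ofReal_mul, hmin] at h
  linarith

end Gain

/-- **GAIN LAW**: per level `k`, some `μ_k > 0` such that the attractive annulus interaction
`−μ_k (W_{ε_k} − W_{ε_{k+1}})` lowers the level-`(k+1)` penalised sector energy by at most `μ_k b_k L²`.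
[folklore] -/
def GainLaw (U δ εs lams : ℝ) (b : ℕ → ℝ) : Prop :=
  ∀ k : ℕ, ∃ μ : ℝ, 0 < μ ∧ ∃ L₀ : ℕ, ∀ (L : ℕ) [NeZero L], L₀ ≤ L → Even L →
    (hubbardTorus 2 L 1 U +
        ((lams / 4 ^ (k + 1) : ℝ) : ℂ) • kacWindowOp L (εs / 2 ^ (k + 1))).minEnergyOn (holeSector L δ) -
      (hubbardTorus 2 L 1 U +
          ((lams / 4 ^ (k + 1) : ℝ) : ℂ) • kacWindowOp L (εs / 2 ^ (k + 1)) -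
        (μ : ℂ) • (kacWindowOp L (εs / 2 ^ k) - kacWindowOp L (εs / 2 ^ (k + 1)))).minEnergyOn
          (holeSector L δ) ≤ μ * b k * (L : ℝ) ^ 2

/-- **Gain ceilings give the annulus law** (minimisers exist on the nonempty sector `K_L`,
`exists_unit_re_rayleigh_eq_minEnergyOn`; then `mul_re_expect_le_gain`). [folklore] -/
theorem annulusLaw_of_gainLaw {U δ εs lams : ℝ} {b : ℕ → ℝ} (hδ : δ ∈ Set.Ioo (0 : ℝ) (1 / 2))
    (h : GainLaw U δ εs lams b) : AnnulusLaw U δ εs lams b := by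
  intro k
  obtain ⟨μ, hμ, L₀, hL⟩ := h k
  refine ⟨L₀, fun L _ hL₀ hE => ?_⟩
  obtain ⟨ψ₀, hψ₀, hψ₀gs⟩ :=
    Summit.HubbardSuperconductivity.NoGo.exists_unit_groundStateInSector_hubbardTorus L 1 U
      (Summit.HubbardSuperconductivity.NoGo.floor_pairNumber_le δ (by linarith [hδ.1]) L)
  obtain ⟨ψ, hψK, hψ, hmin⟩ := exists_unit_re_rayleigh_eq_minEnergyOn
    (hubbardTorus 2 L 1 U + ((lams / 4 ^ (k + 1) : ℝ) : ℂ) • kacWindowOp L (εs / 2 ^ (k + 1)))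
    (holeSector L δ) ⟨ψ₀, hψ₀gs.1, hψ₀⟩
  refine ⟨ψ, hψK, hψ, hmin, ?_⟩
  have hg := mul_re_expect_le_gain _ (kacWindowOp L (εs / 2 ^ k) - kacWindowOp L (εs / 2 ^ (k + 1)))
    (holeSector L δ) (μ := μ) hψK hψ hmin
  have hb := hL L hL₀ hE
  have : μ * (star ψ ⬝ᵥ (kacWindowOp L (εs / 2 ^ k) - kacWindowOp L (εs / 2 ^ (k + 1))) *ᵥ ψ).re ≤
      μ * (b k * (L : ℝ) ^ 2) := by rw [← mul_assoc]; exact hg.trans hb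
  exact le_of_mul_le_mul_left this hμ

/-- **WindowGap from energy differences only**: BASE gap + GAIN ceilings + budget ⟹ the crux.
[folklore] -/
theorem windowGap_of_base_gain {U δ εs lams As a₀ : ℝ} {b : ℕ → ℝ}
    (hU : 0 < U) (hδ : δ ∈ Set.Ioo (0 : ℝ) (1 / 2)) (hε : 0 < εs) (hlam : 0 < lams) (ha₀ : 0 < a₀)
    (hbase : BaseGap U δ εs lams As) (hgain : GainLaw U δ εs lams b)
    (hbudget : ∀ K : ℕ, 2 * a₀ ≤ As - ∑ k ∈ Finset.range K, b k) :
    WindowGap :=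
  windowGap_of_parabolicDescent hU hδ hε hlam ha₀ hbase (annulusLaw_of_gainLaw hδ hgain) hbudget

end Summit.HubbardSuperconductivity.HubbardSuperconductivity.Cruxes.WindowGap.ParabolicDescent
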